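import Summits.CriticalPhenomena.Ising3DConformalLimit.Theorems.StrandShadow.Negative.ClusterDecomposition
import Literature.Probability.LatticeModels.LoopO1
import Literature.Probability.LatticeModels.ModifiedSimonInequality
import HarnessLib

/-!
# (★) The pair-split deletion identity — stub `stub_pairSplit` of line `Sketch` for the crux
`StrandShadow` (stmt-CriticalPhenomena-14626, route `FKParityRobustness`)

For a finite graph `G`, sites `a : Fin 4 → V`, any real `β` and `t = tanh β` (`stub_pairSplit`):
`Σ_{F ∈ 𝒯_{a₀a₁}(G) : a₀ ↝̸_F a₂, a₀ ↝̸_F a₃} t^|F| ⟨σ_{a₂}σ_{a₃}⟩^free_{G, {v | a₀ ↝̸_F v}; β, 0}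
   = Σ_{F ∈ 𝒯_{a(univ)}(G) : a₀ ↝̸_F a₂, a₀ ↝̸_F a₃} t^|F|`.
Proof, on top of the cluster decomposition of `Theorems/StrandShadow/Negative/ClusterDecomposition`
(`Rch`, `clusterEdges`, `edeg`, `dVol`, `clusterIndex`, `fibre_sum`): split `F = K ⊔ R` with
`K = clusterEdges F a₀`; the terminal `a₁` always lies in the `a₀`-cluster (handshake,
`cluster_mem_clusterIndex`), so both clean sums decompose over `clusterIndex G a₀ a₁ a₂ a₃`
(`sum_clean_eq_sum_clusterIndex`); over a fixed `K`, `F ↦ F ∖ K` is a bijection onto the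
`T`-subgraphs of `dVol K a₀` (`fibre_sum`) and the high-temperature expansion
`⟨σ_A⟩^free_Λ = g_Λ(A)/g_Λ(∅)` (`isingCorr_free_eq_hteSum_div`) evaluates both fibres to
`t^|K| g_{dVol K a₀}({a₂, a₃})` (`fibre_pair_eq_fibre_four`).  Full `Mathlib` is imported (through
`ClusterDecomposition`, as in the Theses file), so the `Finset.filter` / `Fin 4` instances of the
statement elaborate exactly as in the crux and in the line skeleton.
Adapted from `Cruxes/StrandShadow/Disproof.lean` §4a (`pairSplit_identity`,
refuter-cdisprove-stmt-CriticalPhenomena-14626-0, 2026-08-16).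
-/

noncomputable section

open Finset SimpleGraph
open Literature.Probability.LatticeModels
open Summit.CriticalPhenomena.Ising3DConformalLimit.StrandShadowNegative

namespace Summit.CriticalPhenomena.Ising3DConformalLimit.Theorems.StrandShadowSketch

open scoped Classical

-- adapted from Cruxes/StrandShadow/Disproof.lean §4a (Assembly)
-- (refuter-cdisprove-stmt-CriticalPhenomena-14626-0, 2026-08-16)

variable {V : Type*} [Fintype V] [DecidableEq V] (G : SimpleGraph V) [DecidableRel G.Adj]

/-- Edge sets inside the depleted volume avoid the vertices reachable inside `K`. -/
theorem avoid_of_subset_edgesIn_dVol {K R : Finset (Sym2 V)} {x : V}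
    (hR : R ⊆ edgesIn G (dVol K x)) : ∀ e ∈ R, ∀ v ∈ e, ¬ Rch K x v :=
  fun _ he v hv => mem_dVol.1 ((mem_edgesIn_iff.1 (hR he)).2 v hv)

/-- The `a₀`-cluster of a clean `T`-join with terminal set `S'`, `{a₀, a₁} ⊆ S' ⊆ {a₀, a₁, a₂, a₃}`,
lies in the cluster index set (the terminal `a₁` is reached: handshake inside the cluster). -/
theorem cluster_mem_clusterIndex {a₀ a₁ a₂ a₃ : V} {S' : Finset V} (h₀₁ : {a₀, a₁} ⊆ S')
    (hS' : S' ⊆ {a₀, a₁} ∪ {a₂, a₃}) {F : Finset (Sym2 V)} (hF : F ∈ tJoins G Set.univ S')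
    (h₂ : ¬ Rch F a₀ a₂) (h₃ : ¬ Rch F a₀ a₃) :
    clusterEdges F a₀ ∈ clusterIndex G a₀ a₁ a₂ a₃ := by
  obtain ⟨hFG, hFodd⟩ := (mem_tJoins_univ G).1 hF
  -- the cluster has the `F`-degree at reachable vertices and degree `0` elsewhere
  have hdeg : ∀ v, edeg (clusterEdges F a₀) v = if Rch F a₀ v then edeg F v else 0 := by
    intro v
    split_ifs with hv
    · have hsplit : edeg F v = edeg (clusterEdges F a₀) v + edeg (F \ clusterEdges F a₀) v := by
        rw [← edeg_union disjoint_sdiff, union_sdiff_of_subset (clusterEdges_subset F a₀)]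
      rw [hsplit, edeg_eq_zero_of_avoid fun e he hve => sdiff_clusterEdges_avoid F a₀ e he v hve
        ((rch_clusterEdges_iff F a₀ v).2 hv), add_zero]
    · exact edeg_eq_zero_of_not_rch (clusterEdges_idem F a₀) (by rwa [rch_clusterEdges_iff])
  have hKodd : ∀ v, Odd (edeg (clusterEdges F a₀) v) ↔ Rch F a₀ v ∧ v ∈ ({a₀, a₁} : Finset V) := by
    intro v
    rw [hdeg v]
    split_ifs with hv
    · rw [hFodd v]
      refine ⟨fun h => ⟨hv, (mem_union.1 (hS' h)).resolve_right fun h' => ?_⟩, fun h => h₀₁ h.2⟩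
      rw [mem_insert, mem_singleton] at h'
      rcases h' with rfl | rfl
      exacts [h₂ hv, h₃ hv]
    · exact ⟨fun h => absurd h Nat.not_odd_zero, fun h => absurd h.1 hv⟩
  -- handshake: `a₁` is reached, since otherwise `a₀` would be the only odd vertex of the cluster
  have h₁ : Rch F a₀ a₁ := by
    by_contra hn
    have heven := even_card_odd_edeg (F := clusterEdges F a₀) fun e he =>
      not_isDiag_of_mem_edgeSet _ (mem_edgeFinset.1 (hFG (clusterEdges_subset F a₀ he)))
    have hO : (univ.filter fun v => Odd (edeg (clusterEdges F a₀) v)) = {a₀} := by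
      ext v
      simp only [mem_filter, mem_univ, true_and, hKodd, mem_insert, mem_singleton]
      exact ⟨fun ⟨hr, h⟩ => h.resolve_right fun h' => hn (h' ▸ hr),
        fun h => h ▸ ⟨rch_refl F _, Or.inl rfl⟩⟩
    rw [hO, card_singleton] at heven
    exact Nat.not_even_one heven
  refine (mem_clusterIndex G).2 ⟨(clusterEdges_subset F a₀).trans hFG, clusterEdges_idem F a₀,
    fun v => ?_, by rwa [rch_clusterEdges_iff], by rwa [rch_clusterEdges_iff]⟩
  rw [hKodd, and_iff_right_iff_imp, mem_insert, mem_singleton]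
  rintro (rfl | rfl)
  exacts [rch_refl F _, h₁]

/-- Outer decomposition: for `{a₀, a₁} ⊆ S' ⊆ {a₀, a₁, a₂, a₃}`, a clean sum over the `S'`-joins is
the sum over `clusterIndex G a₀ a₁ a₂ a₃` of the sums over the fibres `clusterEdges · a₀ = K`. -/
theorem sum_clean_eq_sum_clusterIndex {a₀ a₁ a₂ a₃ : V} {S' : Finset V} (h₀₁ : {a₀, a₁} ⊆ S')
    (hS' : S' ⊆ {a₀, a₁} ∪ {a₂, a₃}) (g : Finset (Sym2 V) → ℝ) :
    ∑ F ∈ (tJoins G Set.univ S').filter (fun F => ¬ Rch F a₀ a₂ ∧ ¬ Rch F a₀ a₃), g F =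
      ∑ K ∈ clusterIndex G a₀ a₁ a₂ a₃,
        ∑ F ∈ (tJoins G Set.univ S').filter (fun F => clusterEdges F a₀ = K), g F := by
  have hmaps : ∀ F ∈ (tJoins G Set.univ S').filter (fun F => ¬ Rch F a₀ a₂ ∧ ¬ Rch F a₀ a₃),
      clusterEdges F a₀ ∈ clusterIndex G a₀ a₁ a₂ a₃ := fun F hF =>
    cluster_mem_clusterIndex G h₀₁ hS' (mem_filter.1 hF).1 (mem_filter.1 hF).2.1
      (mem_filter.1 hF).2.2
  rw [← sum_fiberwise_of_maps_to hmaps g]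
  refine sum_congr rfl fun K hK => sum_congr ?_ fun _ _ => rfl
  obtain ⟨-, -, -, hK₂, hK₃⟩ := (mem_clusterIndex G).1 hK
  ext F
  simp only [mem_filter]
  exact ⟨fun h => ⟨h.1.1, h.2⟩, fun h => ⟨⟨h.1,
    fun h' => hK₂ (h.2 ▸ (rch_clusterEdges_iff F a₀ a₂).2 h'),
    fun h' => hK₃ (h.2 ▸ (rch_clusterEdges_iff F a₀ a₃).2 h')⟩, h.2⟩⟩

/-- Fibre evaluation: over the fibre of an index cluster `K` both sides of (★) equal
`t^|K| · g_{dVol K a₀}({a₂, a₃})`, `t = tanh β` (high-temperature expansion on the pair side). -/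
theorem fibre_pair_eq_fibre_four {a₀ a₁ a₂ a₃ : V} {K : Finset (Sym2 V)}
    (hK : K ∈ clusterIndex G a₀ a₁ a₂ a₃) (β : ℝ) :
    ∑ F ∈ (tJoins G Set.univ {a₀, a₁}).filter (fun F => clusterEdges F a₀ = K),
        Real.tanh β ^ #F * isingCorr G (dVol F a₀) β 0 .free {a₂, a₃} =
      ∑ F ∈ (tJoins G Set.univ ({a₀, a₁} ∪ {a₂, a₃})).filter (fun F => clusterEdges F a₀ = K),
        Real.tanh β ^ #F := by
  obtain ⟨hKG, hKself, hKodd, hK₂, hK₃⟩ := (mem_clusterIndex G).1 hK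
  have hΛ : ({a₂, a₃} : Finset V) ⊆ dVol K a₀ :=
    insert_subset_iff.2 ⟨mem_dVol.2 hK₂, singleton_subset_iff.2 (mem_dVol.2 hK₃)⟩
  have hKR : ∀ R, R ⊆ edgesIn G (dVol K a₀) →
      #(K ∪ R) = #K + #R ∧ dVol (K ∪ R) a₀ = dVol K a₀ := fun R hR =>
    have havoid := avoid_of_subset_edgesIn_dVol G hR
    ⟨card_union_of_disjoint (disjoint_of_avoid hKself havoid), dVol_union_eq havoid⟩
  have hfib := fibre_sum G hKG hKself hKodd (T := ∅) (empty_subset _)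
    (fun F => Real.tanh β ^ #F * isingCorr G (dVol F a₀) β 0 .free {a₂, a₃})
  rw [union_empty] at hfib
  rw [hfib, fibre_sum G hKG hKself hKodd hΛ]
  calc _ = ∑ R ∈ (edgesIn G (dVol K a₀)).powerset with oddVerts (dVol K a₀) R = ∅,
        Real.tanh β ^ #K * (hteSum G (dVol K a₀) (Real.tanh β) {a₂, a₃} /
          hteSum G (dVol K a₀) (Real.tanh β) ∅) * Real.tanh β ^ #R := by
        refine sum_congr rfl fun R hR => ?_
        obtain ⟨hcard, hvol⟩ := hKR R (mem_powerset.1 (mem_filter.1 hR).1)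
        rw [hcard, hvol, pow_add, isingCorr_free_eq_hteSum_div G _ β hΛ]
        ring
    _ = Real.tanh β ^ #K * hteSum G (dVol K a₀) (Real.tanh β) {a₂, a₃} := by
        rw [← mul_sum, mul_assoc]
        exact congrArg _ (div_mul_cancel₀ _ (hteSum_empty_pos G _ β).ne')
    _ = _ := by
        rw [hteSum, mul_sum]
        refine sum_congr rfl fun R hR => ?_
        rw [(hKR R (mem_powerset.1 (mem_filter.1 hR).1)).1, pow_add]

/-- **stub_pairSplit — (★) the pair-split deletion identity** (finite graph, any real `β`): the
depleted pair correlations `⟨σ_{a₂}σ_{a₃}⟩^free_{{v | a₀ ↝̸_F v}}` summed against the weights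
`tanh β ^ |F|` of the `{a₀, a₁}`-joins `F` whose `a₀`-cluster misses `a₂, a₃` give the restricted
`a(univ)`-join sum: both sides decompose over `clusterIndex` with equal fibres. -/
theorem stub_pairSplit :
    ∀ (V : Type) [Fintype V] [DecidableEq V] (G : SimpleGraph V) [DecidableRel G.Adj] (β : ℝ)
      (a : Fin 4 → V),
      (∑ F ∈ (tJoins G Set.univ {a 0, a 1}).filter (fun F : Finset (Sym2 V) =>
            ¬ (SimpleGraph.fromEdgeSet (↑F : Set (Sym2 V))).Reachable (a 0) (a 2) ∧
            ¬ (SimpleGraph.fromEdgeSet (↑F : Set (Sym2 V))).Reachable (a 0) (a 3)),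
          Real.tanh β ^ F.card * isingCorr G (Finset.univ.filter fun v : V =>
            ¬ (SimpleGraph.fromEdgeSet (↑F : Set (Sym2 V))).Reachable (a 0) v) β 0 .free {a 2, a 3})
        = ∑ F ∈ (tJoins G Set.univ (Finset.univ.image a)).filter (fun F : Finset (Sym2 V) =>
            ¬ (SimpleGraph.fromEdgeSet (↑F : Set (Sym2 V))).Reachable (a 0) (a 2) ∧
            ¬ (SimpleGraph.fromEdgeSet (↑F : Set (Sym2 V))).Reachable (a 0) (a 3)),
          Real.tanh β ^ F.card := by
  intro V _ _ G _ β a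
  have himg : (Finset.univ.image a : Finset V) = {a 0, a 1} ∪ {a 2, a 3} := by
    ext v
    simp only [mem_image, mem_univ, true_and, mem_union, mem_insert, mem_singleton]
    constructor
    · rintro ⟨i, rfl⟩
      fin_cases i <;> simp
    · rintro ((rfl | rfl) | (rfl | rfl)) <;> exact ⟨_, rfl⟩
  rw [himg]
  show ∑ F ∈ (tJoins G Set.univ {a 0, a 1}).filter
        (fun F => ¬ Rch F (a 0) (a 2) ∧ ¬ Rch F (a 0) (a 3)),
        Real.tanh β ^ #F * isingCorr G (dVol F (a 0)) β 0 .free {a 2, a 3} =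
      ∑ F ∈ (tJoins G Set.univ ({a 0, a 1} ∪ {a 2, a 3})).filter
        (fun F => ¬ Rch F (a 0) (a 2) ∧ ¬ Rch F (a 0) (a 3)), Real.tanh β ^ #F
  rw [sum_clean_eq_sum_clusterIndex G Subset.rfl subset_union_left,
    sum_clean_eq_sum_clusterIndex G subset_union_left Subset.rfl]
  exact sum_congr rfl fun K hK => fibre_pair_eq_fibre_four G hK β

end Summit.CriticalPhenomena.Ising3DConformalLimit.Theorems.StrandShadowSketch

end
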